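import Mathlib
import Summits.Ventures.HodgeRepro.Tier4.Line1.RTFSetting
import Summits.Ventures.HodgeRepro.Tier4.Line1.SpectralOfRTF
import Summits.Ventures.HodgeRepro.Tier4.Line1.LiftOfPeriods

/-!
# Tier4/Line1/IdentificationSplit — LINE L1, (I4-D): the identification (S1′) SPLIT along its printed seam —
the seesaw identity proper × the Hecke finiteness of the spectrum

Blind re-derivation cell `pub-hodge-repro`, Tier 4 «prove the step» (README §9–§10), seat t4-L1-p4 (gen 3; the cut
(8) of t4-plan-1 g2, bus S13498).  Imports ONLY Mathlib, the generic RTF layer `Tier4/Line1/RTFSetting.lean`,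
t4-L1-p1's `Tier4/Line1/SpectralOfRTF.lean` (`specBlock`, `hasSum_specBlock`, `exists_specBlock_ne_zero`,
`atoms_of_specBlock_ne_zero`, `SpectralIdentification`, `IsolationNonvanishing`, `conclusion_of_rtf_identification`)
and this seat's `Tier4/Line1/LiftOfPeriods.lean` (`PeriodData`).

WHAT THIS IS.  p1's (S1′) `SpectralIdentification S χ χ′ φ n tf spec` («`W.hodgePairing γ = ∑ m ∈ spec γ, specBlock
(tf γ) m` for every choice of translates `γ`») packs TWO printed inputs of different nature.  This module states them
as two DISPLAYED predicates and proves (S1′) from them: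

* **(S1a) `HodgePairingEqJ S χ χ′ tf`** — THE SEESAW IDENTITY PROPER: the concrete Hodge pairing of the choice `γ`
  IS the relative-trace-formula distribution `J(f₁ ⋆ f₂)` at the test pair `tf γ` («pairing of theta lifts = double
  torus period of the kernel», the printed shape of BMM Cor 65 / Liu 2021 Prop 4.13 + night-2's (D0)–(D2) with the
  doubling identity); displayed, proved nowhere;
* **(S1b) `FiniteSpectrum S χ χ′ φ n tf spec`** — HECKE FINITENESS: the test pair of `γ` meets only the blocks of its
  displayed finite spectrum `spec γ` (a property of the CHOICE `tf γ` — F2′ territory); displayed, proved nowhere;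
* **`sum_specBlock_eq_J`** (kernel) — when the blocks outside a finite `s` vanish, `∑ m ∈ s, specBlock m = J(f₁ ⋆ f₂)`
  (p1's `hasSum_specBlock` + `tsum_eq_sum`);
* **`spectralIdentification_of_split`** (kernel) — (S1a) ∧ (S1b) ⟹ (S1′), at every `γ`;
* **`conclusion_of_rtf_split`** — p1's `conclusion_of_rtf_identification` with `hS1` replaced by
  `(htf₁, htf₂, hJ, hfin)`: the residual of LINE L1 with the identification in its two printed rows;
* **`exists_periodData_block_of_isolation`** — the DEFINED content pins the period index to a NON-ZERO BLOCK of the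
  isolated orbital term (p1's `exists_specBlock_ne_zero` + `atoms_of_specBlock_ne_zero` after
  `J_eq_orbital_of_isolated`), as one name;
* **`hodgePairing_eq_zero_of_spec_eq_empty`** — the junk test in the kernel: with empty spectra, (S1a) ∧ (S1b) force
  `W.hodgePairing ≡ 0` (so no cheap instance satisfies (S1a) ∧ (S1b) ∧ (P)).

Nothing here proves the identification; `tf`, `spec` are DATA of the residual; nothing is said about `P_T4` or the
twisted member.  Nothing here says anything about the status of the Hodge conjecture for CM abelian varieties, which
is NOT proved (HC_CM is NOT proved by anyone in this repository).
-/

set_option autoImplicit false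

noncomputable section

namespace Summit.Ventures.HodgeRepro.Tier4.Line1

open NumberField Common PeriodCloser MeasureTheory

namespace RTF.Setting

section Blocks

variable {G : Type} [Group G] [TopologicalSpace G] [IsTopologicalGroup G] [MeasurableSpace G] [BorelSpace G]
  (S : Setting G) (χ : S.T → ℂ) (χ' : S.T' → ℂ) (φ : ℕ → G → ℂ) (n : ℕ → ℕ) (f₁ f₂ : G → ℂ)

/-- **The finite block sum is `J`**: when every block outside the finite set `s` vanishes, the sum of the blocks
over `s` is `J(f₁ ⋆ f₂)` (p1's `hasSum_specBlock` with `tsum_eq_sum`). -/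
theorem sum_specBlock_eq_J (hχ : S.IsCharacter χ) (hχ' : S.IsCharacter' χ') {τ : ℕ → Set (G → ℂ)}
    (hB : S.IsAdaptedONB τ φ n) (h₁ : IsTest f₁) (h₂ : IsTest f₂) {s : Finset ℕ}
    (hs : ∀ m ∉ s, specBlock S χ χ' φ n f₁ f₂ m = 0) :
    ∑ m ∈ s, specBlock S χ χ' φ n f₁ f₂ m = S.J χ χ' (S.conv f₁ f₂) := by
  have h := S.hasSum_specBlock χ χ' φ n f₁ f₂ hχ hχ' hB h₁ h₂
  rw [← h.tsum_eq, tsum_eq_sum hs]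

/-- **The period index of the DEFINED content is a non-zero block of the isolated orbital term**: with
`geoSupport (f₁ ⋆ f₂) = {o₀}` and `orbital o₀ ≠ 0`, `J(f₁ ⋆ f₂) = orbital o₀ ≠ 0`, some block `m` is non-zero,
and that `m` carries `PeriodData` (both toric functionals on `τ m`, hit by `f̄₁`). -/
theorem exists_periodData_block_of_isolation (hχ : S.IsCharacter χ) (hχ' : S.IsCharacter' χ')
    {τ : ℕ → Set (G → ℂ)} (hB : S.IsAdaptedONB τ φ n) (h₁ : IsTest f₁) (h₂ : IsTest f₂)
    (hconv : IsTest (S.conv f₁ f₂)) {o₀ : S.Orbit} (hiso : S.geoSupport (S.conv f₁ f₂) = {o₀})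
    (hne : S.orbital χ χ' o₀ (S.conv f₁ f₂) ≠ 0) :
    ∃ m, S.PeriodData χ χ' τ f₁ m ∧ specBlock S χ χ' φ n f₁ f₂ m ≠ 0 := by
  have hJ : S.J χ χ' (S.conv f₁ f₂) ≠ 0 := by
    rw [S.J_eq_orbital_of_isolated hχ hχ' hconv hiso]
    exact hne
  obtain ⟨m, hm⟩ := S.exists_specBlock_ne_zero χ χ' φ n f₁ f₂ hχ hχ' hB h₁ h₂ hJ
  obtain ⟨hT, hT', hhit⟩ := S.atoms_of_specBlock_ne_zero χ χ' φ n f₁ f₂ hB h₁ h₂ hm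
  exact ⟨m, ⟨hT, hT', hhit⟩, hm⟩

end Blocks

end RTF.Setting

section Split

variable {Form : Type} [AddCommGroup Form] [Module ℂ Form] {A : FormAlgebra Form} {W : Witness A}
  {G : Type} [Group G] [TopologicalSpace G] [IsTopologicalGroup G] [MeasurableSpace G] [BorelSpace G]
  (S : RTF.Setting G) (χ : S.T → ℂ) (χ' : S.T' → ℂ) (φ : ℕ → G → ℂ) (n : ℕ → ℕ)
  (tf : W.Translates → (G → ℂ) × (G → ℂ)) (spec : W.Translates → Finset ℕ)

/-- **(S1a) — THE SEESAW IDENTITY PROPER, DISPLAYED**: the concrete Hodge pairing `⟨f^*Ω_s, f^*Ω_{s̄}⟩_{L²(X)}` of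
the choice `γ` is the relative-trace-formula distribution `J(f₁ ⋆ f₂)` at the test pair `tf γ` (the printed shape
«pairing of theta lifts = double torus period of the kernel»: BMM Cor 65 / Liu 2021 Prop 4.13 for the corner forms,
night-2's (D0)–(D2) and the doubling identity for the pairing).  A HYPOTHESIS wherever it is used; proved nowhere. -/
def HodgePairingEqJ : Prop :=
  ∀ γ : W.Translates, W.hodgePairing γ = S.J χ χ' (S.conv (tf γ).1 (tf γ).2)

/-- **(S1b) — HECKE FINITENESS, DISPLAYED**: the test pair of the choice `γ` meets only the blocks of its displayed
finite spectrum `spec γ` (every other block of the spectral expansion at `tf γ` vanishes) — a property of the CHOICE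
of test data (the admissible projector / level structure in `tf γ`, F2′ territory).  A HYPOTHESIS wherever it is
used; proved nowhere. -/
def FiniteSpectrum : Prop :=
  ∀ (γ : W.Translates) (m : ℕ), m ∉ spec γ → S.specBlock χ χ' φ n (tf γ).1 (tf γ).2 m = 0

/-- **(S1a) ∧ (S1b) ⟹ (S1′)**: at every `γ`, rewrite the Hodge pairing by the seesaw identity and regroup `J` into
the finite sum of the blocks of `spec γ` (`sum_specBlock_eq_J`). -/
theorem spectralIdentification_of_split (hχ : S.IsCharacter χ) (hχ' : S.IsCharacter' χ')
    {τ : ℕ → Set (G → ℂ)} (hB : S.IsAdaptedONB τ φ n) (htf₁ : ∀ γ, RTF.IsTest (tf γ).1)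
    (htf₂ : ∀ γ, RTF.IsTest (tf γ).2) (hJ : HodgePairingEqJ S χ χ' tf)
    (hfin : FiniteSpectrum S χ χ' φ n tf spec) : SpectralIdentification S χ χ' φ n tf spec := by
  intro γ
  rw [hJ γ, S.sum_specBlock_eq_J χ χ' φ n (tf γ).1 (tf γ).2 hχ hχ' hB (htf₁ γ) (htf₂ γ) (hfin γ)]

/-- **The junk test in the kernel**: with empty spectra, (S1a) ∧ (S1b) force the Hodge pairing of every choice to
vanish — no cheap instance of the two displayed identities is compatible with (P). -/
theorem hodgePairing_eq_zero_of_spec_eq_empty (hχ : S.IsCharacter χ) (hχ' : S.IsCharacter' χ')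
    {τ : ℕ → Set (G → ℂ)} (hB : S.IsAdaptedONB τ φ n) (htf₁ : ∀ γ, RTF.IsTest (tf γ).1)
    (htf₂ : ∀ γ, RTF.IsTest (tf γ).2) (hJ : HodgePairingEqJ S χ χ' tf)
    (hfin : FiniteSpectrum S χ χ' φ n tf spec) (hspec : ∀ γ, spec γ = ∅) (γ : W.Translates) :
    W.hodgePairing γ = 0 := by
  rw [spectralIdentification_of_split S χ χ' φ n tf spec hχ hχ' hB htf₁ htf₂ hJ hfin γ, hspec γ,
    Finset.sum_empty]

end Split

section Target

variable {F E : Type} [Field F] [NumberField F] [IsGalois ℚ F] [IsCMField F]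
  [Field E] [NumberField E] [IsGalois ℚ E] [IsCMField E]

/-- **The conclusion of `P_T4` for a datum `d` with the identification in its two printed rows** — p1's
`conclusion_of_rtf_identification` with `hS1` (S1′) replaced by (S1a) `HodgePairingEqJ`, (S1b) `FiniteSpectrum` and
the per-choice test hypotheses `htf₁`, `htf₂` (the same ones the face form asks); every other binder is p1's,
verbatim. -/
theorem conclusion_of_rtf_split (d : TargetData F E) {Γ' : Set (Matrix (Fin 3) (Fin 3) E)}
    (hΓ' : d.IsLevel Γ') (hcc : d.IsCocompact Γ')
    {G : Type} [Group G] [TopologicalSpace G] [IsTopologicalGroup G] [MeasurableSpace G] [BorelSpace G]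
    (S : RTF.Setting G) {χ : S.T → ℂ} {χ' : S.T' → ℂ} (hχ : S.IsCharacter χ) (hχ' : S.IsCharacter' χ')
    {τ : ℕ → Set (G → ℂ)} {φ : ℕ → G → ℂ} {n : ℕ → ℕ} (hB : S.IsAdaptedONB τ φ n) {f₁ f₂ : G → ℂ}
    (h₁ : RTF.IsTest f₁) (h₂ : RTF.IsTest f₂) (hconv : RTF.IsTest (S.conv f₁ f₂)) {o₀ : S.Orbit}
    (hiso : S.geoSupport (S.conv f₁ f₂) = {o₀}) (hne : S.orbital χ χ' o₀ (S.conv f₁ f₂) ≠ 0)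
    (Lift : ℕ → Prop)
    (hlift : ∀ m, S.PeriodNonzeroT χ (τ m) → S.PeriodNonzeroT' χ' (τ m) → S.Hit (RTF.cj f₁) (τ m) → Lift m)
    (tf : (d.concreteWitness hΓ' (isDomain_dom d hΓ').subset_ball (isDomain_dom d hΓ').measurableSet
      (d.residual_of_cocompact hΓ' hcc)).Translates → (G → ℂ) × (G → ℂ))
    (spec : (d.concreteWitness hΓ' (isDomain_dom d hΓ').subset_ball (isDomain_dom d hΓ').measurableSet
      (d.residual_of_cocompact hΓ' hcc)).Translates → Finset ℕ)
    (htf₁ : ∀ γ, RTF.IsTest (tf γ).1) (htf₂ : ∀ γ, RTF.IsTest (tf γ).2)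
    (hJ : HodgePairingEqJ S χ χ' tf) (hfin : FiniteSpectrum S χ χ' φ n tf spec)
    (hS3 : IsolationNonvanishing S χ χ' τ Lift φ n tf spec) : d.conclusion :=
  conclusion_of_rtf_identification d hΓ' hcc S hχ hχ' hB h₁ h₂ hconv hiso hne Lift hlift tf spec
    (spectralIdentification_of_split S χ χ' φ n tf spec hχ hχ' hB htf₁ htf₂ hJ hfin) hS3

end Target

end Summit.Ventures.HodgeRepro.Tier4.Line1

end
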